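import Literature.NumberTheory.EllipticCurves.NewformOpenImageGaloisProofs
import Literature.NumberTheory.EllipticCurves.FramedTateGaloisRep
import Literature.NumberTheory.EllipticCurves.SupersingularDensitySerreHoldsProofs
import Literature.NumberTheory.EllipticCurves.SerreOpenImageDensityProofs
import Literature.NumberTheory.EllipticCurves.IsogenyFrobeniusTraceProofs
import Literature.NumberTheory.EllipticCurves.HasseWeilGoodReductionProofs
import Literature.NumberTheory.EllipticCurves.GoodReductionUnramifiedProofs
import Literature.NumberTheory.EllipticCurves.FrobeniusTateModuleProofs
import Literature.NumberTheory.EllipticCurves.LFunctionPrimeCoeff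
import Literature.NumberTheory.EllipticCurves.SupersingularDensitySerreFrobeniusProofs
import Literature.NumberTheory.GaloisRepresentations.OddAbsolutelyIrreducibleProofs
import Literature.NumberTheory.GaloisRepresentations.GoodDihedralLocalImage
import Literature.AlgebraicGeometry.Motives.FaltingsECEndOfCoreProofs
import HarnessLib

/-!
# The `p`-adic open image theorem for a non-CM elliptic curve over `ℚ` at EVERY prime `p`
# (Serre 1968, IV-11; 1972 §4.4): `Im(Γ_ℚ → Aut(T_pE) ≅ GL₂(ℤ_p)) ⊇ Γ(pˢ)` (proofs file)

Topic `NumberTheory/EllipticCurves`.  Theorems only (no definition, no named fact, no `sorry`).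
Cell `bsd-potss` (HOME `run/shared/lean/pub/bsd-potss/`), seat `bsd-potss-k8q-c2x` g5 (prover; lane B
of the K8 Kato side, route `QuadraticBranchSignedControl`).  HONEST FRAMING: BSD is not proved by any
of this; this is classical Galois theory of elliptic curves proved in the kernel from the tree's
theorems; its consumer is Kato's hypothesis (v) of Astérisque 295 Thm. 13.4 for NON-CM curves.

* `WeierstrassCurve.exists_congruenceSubgroup_le_of_not_hasCM` — for a globally minimal `E = W/ℚ`
  WITHOUT (geometric) complex multiplication, every prime `p` and every `ℤ_p`-basis `b` of `T_pE`,
  there is `s ≥ 2` such that EVERY `M ∈ GL₂(ℤ_p)` with `M ≡ 1 (mod pˢ)` is the matrix in `b` of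
  `ρ_{E,p}(σ)` for some `σ ∈ Γ_ℚ`: the image of `ρ_{E,p}` contains `Γ(pˢ)`, so it is OPEN (Serre
  1968, IV-11, Théorème: "If `E` has no complex multiplication, then `𝔤_ℓ = End(V_ℓ)`, i.e.
  `Im(ρ_ℓ)` is open in `Aut(T_ℓ)`", every `ℓ`; Serre 1972, §4.4 Thm. 3).

PROOF — the proof of `momose_isOpen_range_galoisRep_of_thm23` (`NewformOpenImageGaloisProofs`; Ribet
1977 §4–5 / 1985 §3 after Serre, Momose) with elliptic-curve inputs.  Frame `V_pE` in `1 ⊗ b`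
(`ContinuousRep.frame`, Mathlib `LinearMap.toMatrix_baseChange`: the matrices are those of `T_pE`),
`G = Im ρ ≤ GL₂(ℤ_p)` (closed), `U = ρ⁻¹(Γ(p³))` (open, finite index).  By the `ℓ`-adic Lie engine
`OpenImage.exists_meets_of_forall_exists_not_eigenline_of_det_ne_one` and successive approximation
`OpenImage.congruenceSubgroup_le_of_isClosed` it suffices that (1) `ρ(U)` has no common eigenvector
over `ℚ̄_p` and (2) `ρ(U) ∌` only determinant-`1` elements.  (2): `det ρ(Frob_q) = q`
(`det_galoisRepTate_frobenius_of_hasGoodReductionAt_holds`), `Frob_qⁿ ∈ U`.  (1): `V_pE` has no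
`Γ_ℚ`-stable line (`finrank_ne_one_of_stable_of_not_hasRationalCM_of_numberField`: Serre IV.2.1 via
Shafarevich–Faltings finiteness, proved in the tree) and is ODD (`det ρ = χ_p`,
`det_galoisRepTate_eq_cyclotomicCharacter_holds`; `χ_p(c) = −1`), hence absolutely irreducible
(`FramedRep.isAbsolutelyIrreducible_of_isIrreducible_of_det_eq_neg_one`); by Clifford theory
(`OpenImage.scalar_or_index_two_of_eigenline`) a common eigenvector of the normal core `V` of `U`
gives either (A) `ρ(V)` scalar — a Frobenius in `V` (Chebotarev, `frobenius_dense`) has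
`a_q² = 4q` (`tr ρ(Frob_q) = a_q`, `trace_galoisRepTate_frobenius_eq_frobeniusTrace`), impossible
(`OpenImage.sq_ne_four_mul_prime_pow`) — or (B) an open index-`2` subgroup `H ⊇ V` with `tr ρ = 0`
off `H`; `H` contains the inertia at good `q ≠ p` (`galoisRepTate_eq_one_of_mem_inertia`) and every
good `q` with a Frobenius outside `H` has `a_q = 0`, i.e. is supersingular — contradicting density
`0` (`serre_supersingular_density_zero_holds`, Serre 1981 §8) through
`false_of_frobenius_not_mem_subset_density_zero` (Serre 1972 §4.2 c)).

References: [SerreAbelianLadic1968] Ch. IV §2.2 Théorème (IV-11), §3.4 Lemma 3 (IV-23);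
[Serre1972] §4.2 c), §4.4 Thm. 3; [Ribet1977Nebentypus] §4 (Thm. (4.3), Prop. (4.4)), Thm. (5.7).
-/
noncomputable section

open scoped MatrixGroups NumberField Matrix
open Field IsDedekindDomain Filter Topology Rat.HeightOneSpectrum
open Literature.NumberTheory.GaloisRepresentations Literature.NumberTheory.EllipticCurves
open Literature.NumberTheory.EllipticCurves.ModularForms
open Literature.NumberTheory.EllipticCurves.ModularForms.OpenImage Literature.GroupTheory.Index

namespace WeierstrassCurve

namespace TateOpenImage

variable {p : ℕ} [Fact p.Prime]

/-- `ι : GL₂(ℤ_p) → GL₂(ℚ_p)` is injective. [folklore] -/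
private theorem glMap_coe_injective :
    Function.Injective (Matrix.GeneralLinearGroup.map (PadicInt.Coe.ringHom (p := p)) :
      GL (Fin 2) ℤ_[p] → GL (Fin 2) ℚ_[p]) := by
  intro a b h
  apply Units.ext
  have h' := congrArg (fun g : GL (Fin 2) ℚ_[p] => (g : Matrix (Fin 2) (Fin 2) ℚ_[p])) h
  simp only [coe_map_coeRingHom] at h'
  exact Matrix.map_injective (fun x y hxy => Subtype.ext hxy) h'

/-- Trace of an integral matrix read in `ℚ_p`. [folklore] -/
private theorem trace_map_coe (M : Matrix (Fin 2) (Fin 2) ℤ_[p]) :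
    (M.map ((↑) : ℤ_[p] → ℚ_[p])).trace = ((M.trace : ℤ_[p]) : ℚ_[p]) := by
  rw [Matrix.trace_fin_two, Matrix.trace_fin_two, Matrix.map_apply, Matrix.map_apply, PadicInt.coe_add]

/-- Determinant of an integral matrix read in `ℚ_p`. [folklore] -/
private theorem det_map_coe (M : Matrix (Fin 2) (Fin 2) ℤ_[p]) :
    (M.map ((↑) : ℤ_[p] → ℚ_[p])).det = ((M.det : ℤ_[p]) : ℚ_[p]) := by
  have e := RingHom.map_det (PadicInt.Coe.ringHom (p := p)) M
  rw [RingHom.mapMatrix_apply] at e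
  exact e.symm

end TateOpenImage

open TateOpenImage

/-- **The `p`-adic open image theorem for non-CM elliptic curves over `ℚ` (Serre 1968, IV-11; 1972,
§4.4 Thm. 3), integral form at every prime.**  For a globally minimal elliptic curve `E = W/ℚ`
WITHOUT (geometric) complex multiplication, a prime `p` and a `ℤ_p`-basis `b` of `T_pE`, there is
`s ≥ 2` such that every `M ∈ GL₂(ℤ_p)` with `M ≡ 1 (mod pˢ)` (`GL2.congruenceSubgroup s`) is the
matrix in `b` of `ρ_{E,p}(σ)` for some `σ ∈ Gal(ℚ̄/ℚ)`: `Im ρ_{E,p} ⊇ Γ(pˢ)` (so it is open).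
Proof: module docstring. [cite: SerreAbelianLadic1968, Ch. IV §2.2 Théorème (IV-11) and §3.4 Lemma 3 (IV-23)]
[cite: Serre1972, §4.2 c) and §4.4 Thm. 3] [cite: Ribet1977Nebentypus, §4 (Thm. (4.3), Prop. (4.4)) and Thm. (5.7)] -/
theorem exists_congruenceSubgroup_le_of_not_hasCM (W : WeierstrassCurve ℚ) [W.IsElliptic]
    [W.IsGloballyMinimal] (hW : ¬ W.HasCM) (p : ℕ) [Fact p.Prime]
    (bT : Module.Basis (Fin 2) ℤ_[p] (W.tateModule p)) :
    ∃ s : ℕ, 2 ≤ s ∧ ∀ M : GL (Fin 2) ℤ_[p], M ∈ GL2.congruenceSubgroup (p := p) s →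
      ∃ σ : absoluteGaloisGroup ℚ,
        LinearMap.toMatrix bT bT (W.galoisRepTate p σ) = (M : Matrix (Fin 2) (Fin 2) ℤ_[p]) := by
  classical
  have hp : p.Prime := Fact.out
  have hp0 : (p : ℚ) ≠ 0 := Nat.cast_ne_zero.mpr hp.ne_zero
  haveI : Module.Free ℤ_[p] (W.tateModule p) := module_free_tateModule_holds W p
  haveI : Module.Finite ℤ_[p] (W.tateModule p) := module_finite_tateModule_holds W p
  have hCMr : ¬ W.HasRationalCM := fun h => hW h.hasCM
  set ρT := W.galoisRepTate p with hρT
  /- the integral frame `ρint : Γ_ℚ → GL₂(ℤ_p)` in the basis `bT` -/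
  let ρint : absoluteGaloisGroup ℚ →* GL (Fin 2) ℤ_[p] :=
    { toFun := fun τ => ⟨LinearMap.toMatrix bT bT (ρT τ), LinearMap.toMatrix bT bT (ρT τ⁻¹),
        by rw [← LinearMap.toMatrix_mul, ← map_mul, mul_inv_cancel, map_one, LinearMap.toMatrix_one],
        by rw [← LinearMap.toMatrix_mul, ← map_mul, inv_mul_cancel, map_one, LinearMap.toMatrix_one]⟩
      map_one' := Units.ext (by simp [LinearMap.toMatrix_one])
      map_mul' := fun g h => Units.ext (by simp [LinearMap.toMatrix_mul]) }
  have hρint : ∀ τ, ((ρint τ : GL (Fin 2) ℤ_[p]) : Matrix (Fin 2) (Fin 2) ℤ_[p]) =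
      LinearMap.toMatrix bT bT (ρT τ) := fun τ => rfl
  /- the rational frame `ρ : Γ_ℚ →ₜ* GL₂(ℚ_p)` in the basis `1 ⊗ bT` of `V_pE` -/
  let bV : Module.Basis (Fin 2) ℚ_[p] (W.rationalTateModule p) := Algebra.TensorProduct.basis ℚ_[p] bT
  set ρ : FramedGaloisRep ℚ ℚ_[p] 2 :=
    (rationalTateGaloisRepOf (geomPoints W) p (W.continuous_rationalGaloisRepTate_holds p)).frame bV
    with hρdef
  have hρV : ∀ τ, (rationalTateGaloisRepOf (geomPoints W) p
      (W.continuous_rationalGaloisRepTate_holds p)) τ = W.rationalGaloisRepTate p τ := fun τ => rfl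
  have hρmat : ∀ τ, ((ρ τ : GL (Fin 2) ℚ_[p]) : Matrix (Fin 2) (Fin 2) ℚ_[p]) =
      (LinearMap.toMatrix bT bT (ρT τ)).map ((↑) : ℤ_[p] → ℚ_[p]) := by
    intro τ
    rw [hρdef, ContinuousRep.coe_frame_apply, hρV, rationalGaloisRepTate_eq_baseChange]
    have key := LinearMap.toMatrix_baseChange ℚ_[p] (ρT τ) bT bT
    exact key
  have hρι : ∀ τ, Matrix.GeneralLinearGroup.map (PadicInt.Coe.ringHom (p := p)) (ρint τ) = ρ τ := by
    intro τ
    apply Units.ext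
    rw [coe_map_coeRingHom, hρint, hρmat]
  set G : Subgroup (GL (Fin 2) ℤ_[p]) :=
    (ρ.toMonoidHom.range).comap (Matrix.GeneralLinearGroup.map (PadicInt.Coe.ringHom (p := p))) with hG
  have hmemG : ∀ {g : GL (Fin 2) ℤ_[p]}, g ∈ G ↔ ∃ τ, ρint τ = g := by
    intro g
    rw [hG, Subgroup.mem_comap, MonoidHom.mem_range]
    constructor
    · rintro ⟨τ, hτ⟩
      refine ⟨τ, glMap_coe_injective ?_⟩
      rw [hρι]
      exact hτ
    · rintro ⟨τ, rfl⟩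
      exact ⟨τ, (hρι τ).symm⟩
  set U : Subgroup (absoluteGaloisGroup ℚ) := (GL2.congruenceSubgroup (p := p) 3).comap ρint with hU
  have hmemU : ∀ {τ}, τ ∈ U ↔ ρint τ ∈ GL2.congruenceSubgroup (p := p) 3 := fun {τ} => Subgroup.mem_comap
  have hUopen : IsOpen (U : Set (absoluteGaloisGroup ℚ)) := by
    have h := isOpen_of_map_congruenceSubgroup_le (ℓ := p) (m := 3) (by norm_num)
      (S := (GL2.congruenceSubgroup (p := p) 3).map
        (Matrix.GeneralLinearGroup.map (PadicInt.Coe.ringHom (p := p)))) le_rfl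
    have hUeq : (U : Set (absoluteGaloisGroup ℚ)) = ρ ⁻¹'
        (((GL2.congruenceSubgroup (p := p) 3).map
          (Matrix.GeneralLinearGroup.map (PadicInt.Coe.ringHom (p := p))) :
            Subgroup (GL (Fin 2) ℚ_[p])) : Set (GL (Fin 2) ℚ_[p])) := by
      ext τ
      rw [SetLike.mem_coe, hmemU, Set.mem_preimage, SetLike.mem_coe, Subgroup.mem_map]
      constructor
      · intro h3
        exact ⟨ρint τ, h3, hρι τ⟩
      · rintro ⟨g, hg, hgτ⟩
        rwa [← glMap_coe_injective (hgτ.trans (hρι τ).symm)]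
    rw [hUeq]
    exact h.preimage (map_continuous ρ)
  haveI : Finite (absoluteGaloisGroup ℚ ⧸ U) := Subgroup.quotient_finite_of_isOpen U hUopen
  haveI hUfi : U.FiniteIndex := Subgroup.finiteIndex_of_finite_quotient
  set Sbad : Set ℕ := {q | q = p} ∪ {q | ∃ _ : Fact q.Prime, ¬ W.HasGoodReductionAtPrime q} with hSbad
  have hSbad_fin : Sbad.Finite :=
    (Set.finite_singleton p).union W.finite_setOf_prime_not_hasGoodReductionAtPrime
  have hgoodq : ∀ q : ℕ, q.Prime → q ∉ Sbad → ∀ v : HeightOneSpectrum (𝓞 ℚ), (primesEquiv v : ℕ) = q →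
      (primesEquiv v : ℕ) ≠ p ∧ (haveI := Fact.mk (primesEquiv v).2;
        W.HasGoodReductionAtPrime (primesEquiv v)) ∧ W.HasGoodReductionAt v := by
    intro q hq hqS v hv
    subst hv
    have hne : (primesEquiv v : ℕ) ≠ p := fun h => hqS (Or.inl h)
    have hgp : (haveI := Fact.mk (primesEquiv v).2; W.HasGoodReductionAtPrime (primesEquiv v)) := by
      by_contra hbad
      exact hqS (Or.inr ⟨Fact.mk hq, hbad⟩)
    exact ⟨hne, hgp, (hasGoodReductionAtPrime_iff_hasGoodReductionAt_ringOfIntegers v W).mp hgp⟩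
  set Spl : Set (HeightOneSpectrum (𝓞 ℚ)) := {v | ((primesEquiv v : Nat.Primes) : ℕ) ∈ Sbad} with hSpl
  have hSpl_fin : Spl.Finite :=
    hSbad_fin.preimage (f := fun v : HeightOneSpectrum (𝓞 ℚ) ↦ ((primesEquiv v : Nat.Primes) : ℕ))
      fun v _ w _ h ↦ primesEquiv.injective (Subtype.ext h)
  have hgoodv : ∀ {v : HeightOneSpectrum (𝓞 ℚ)}, v ∉ Spl →
      (primesEquiv v : ℕ) ≠ p ∧ W.HasGoodReductionAt v := by
    intro v hv
    obtain ⟨hne, -, hg⟩ := hgoodq _ (primesEquiv v).2 hv v rfl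
    exact ⟨hne, hg⟩
  /- Frobenius data: `tr ρ(Frob_q) = a_q`, `det ρ(Frob_q) = q` at good `q ≠ p` -/
  have hgood : ∀ {v : HeightOneSpectrum (𝓞 ℚ)}, (primesEquiv v : ℕ) ≠ p → W.HasGoodReductionAt v →
      ∀ {𝔓 : Ideal (absIntegers (𝓞 ℚ) ℚ)}, 𝔓 ∈ v.primesAbove → ∀ {σ : absoluteGaloisGroup ℚ},
        IsArithFrobAt (𝓞 ℚ) σ 𝔓 →
        ((ρ σ : GL (Fin 2) ℚ_[p]) : Matrix (Fin 2) (Fin 2) ℚ_[p]).trace =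
            ((W.frobeniusTrace (primesEquiv v) : ℚ) : ℚ_[p]) ∧
          ((ρ σ : GL (Fin 2) ℚ_[p]) : Matrix (Fin 2) (Fin 2) ℚ_[p]).det =
            (((primesEquiv v : Nat.Primes) : ℕ) : ℚ_[p]) := by
    intro v hne hv 𝔓 h𝔓 σ hσ
    have hℓ : (p : 𝓞 ℚ) ∉ v.asIdeal := natCast_not_mem_asIdeal_of_primesEquiv_ne hp hne
    have htr := W.trace_galoisRepTate_frobenius_eq_frobeniusTrace p hne hv h𝔓 hσ
    have hdet := W.det_galoisRepTate_frobenius_of_hasGoodReductionAt_holds p v hℓ hv h𝔓 hσ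
    rw [natCard_residueField_adicCompletionIntegers v] at hdet
    constructor
    · rw [hρmat, trace_map_coe, ← LinearMap.trace_eq_matrix_trace ℤ_[p] bT (ρT σ), hρT, htr]
      push_cast
      rfl
    · rw [hρmat, det_map_coe, LinearMap.det_toMatrix bT, hρT, hdet]
      push_cast
      rfl
  /- (2) an element of `G ∩ Γ(p³)` of determinant `≠ 1`: a power of a Frobenius -/
  have hdet : ∃ g ∈ G, g ∈ GL2.congruenceSubgroup (p := p) 3 ∧
      (g : Matrix (Fin 2) (Fin 2) ℤ_[p]).det ≠ 1 := by
    obtain ⟨B, hB⟩ := hSbad_fin.bddAbove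
    obtain ⟨p₀, hp₀ge, hp₀⟩ := Nat.exists_infinite_primes (B + 1)
    have hp₀S : p₀ ∉ Sbad := fun h => by
      have := hB h
      omega
    obtain ⟨v₀, hv₀⟩ : ∃ v₀ : HeightOneSpectrum (𝓞 ℚ), (primesEquiv v₀ : ℕ) = p₀ :=
      ⟨primesEquiv.symm ⟨p₀, hp₀⟩, by rw [Equiv.apply_symm_apply]⟩
    obtain ⟨hne₀, -, hgood₀⟩ := hgoodq p₀ hp₀ hp₀S v₀ hv₀
    obtain ⟨𝔓, h𝔓⟩ := HeightOneSpectrum.primesAbove_nonempty v₀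
    obtain ⟨σ₀, hσ₀⟩ :=
      HeightOneSpectrum.exists_isArithFrobAt_of_mem_primesAbove_holds (K := ℚ) (v := v₀) h𝔓
    obtain ⟨-, hdet₀⟩ := hgood hne₀ hgood₀ h𝔓 hσ₀
    rw [hv₀] at hdet₀
    obtain ⟨n, hn, -, hσ₀n⟩ := Subgroup.exists_pow_mem_of_index_ne_zero hUfi.index_ne_zero σ₀
    refine ⟨ρint (σ₀ ^ n), hmemG.2 ⟨_, rfl⟩, hmemU.1 hσ₀n, fun hdet1 => ?_⟩
    have h1 : (((ρ σ₀ : GL (Fin 2) ℚ_[p]) : Matrix (Fin 2) (Fin 2) ℚ_[p]).det) ^ n = 1 := by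
      rw [← Matrix.det_pow, ← Units.val_pow_eq_pow_val, ← map_pow, ← hρι, coe_map_coeRingHom,
        det_map_coe, hdet1, PadicInt.coe_one]
    rw [hdet₀] at h1
    have h2 : ((p₀ ^ n : ℕ) : ℚ_[p]) = 1 := by exact_mod_cast h1
    have h3 : p₀ ^ n = 1 := by exact_mod_cast h2
    have h4 : 1 < p₀ ^ n := Nat.one_lt_pow hn.ne' hp₀.one_lt
    omega
  /- (1) no invariant line on `G ∩ Γ(p³)` over `ℚ̄_p` -/
  set E := AlgebraicClosure ℚ_[p] with hEdef
  have hsq : ∀ d : ℚ_[p], ∃ μ : E, μ * μ = algebraMap ℚ_[p] E d := fun d ↦ by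
    obtain ⟨μ, hμ⟩ := IsAlgClosed.exists_eq_mul_self (algebraMap ℚ_[p] E d)
    exact ⟨μ, hμ.symm⟩
  -- irreducibility over `ℚ_p`: no `Γ_ℚ`-stable line in `V_pE` (`End(E) = ℤ`)
  have hirrQ : FramedRep.IsIrreducible ρ := by
    refine isIrreducible_of_not_hasCommonEigenvector ρ.toMonoidHom ?_
    rintro ⟨w, hw0, hw⟩
    set x : W.rationalTateModule p := bV.equivFun.symm w with hxdef
    have hxw' : ∀ i, bV.repr x i = w i := fun i => by
      rw [← Module.Basis.equivFun_apply, hxdef, LinearEquiv.apply_symm_apply]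
    have hx0 : x ≠ 0 := by
      intro hx
      apply hw0
      funext i
      rw [← hxw' i, hx, map_zero, Finsupp.zero_apply]
      rfl
    have hσx : ∀ σ : absoluteGaloisGroup ℚ, ∃ a : ℚ_[p], W.rationalGaloisRepTate p σ x = a • x := by
      intro σ
      obtain ⟨a, ha⟩ := hw σ
      refine ⟨a, ?_⟩
      have hmv := LinearMap.toMatrix_mulVec_repr bV bV (W.rationalGaloisRepTate p σ) x
      have hmat : LinearMap.toMatrix bV bV (W.rationalGaloisRepTate p σ) =
          ((ρ σ : GL (Fin 2) ℚ_[p]) : Matrix (Fin 2) (Fin 2) ℚ_[p]) := by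
        rw [hρdef, ContinuousRep.coe_frame_apply, hρV]
      have hreprw : ⇑(bV.repr x) = w := funext hxw'
      rw [hmat, hreprw] at hmv
      change ((ρ σ : GL (Fin 2) ℚ_[p]) : Matrix (Fin 2) (Fin 2) ℚ_[p]) *ᵥ w = a • w at ha
      rw [ha] at hmv
      apply bV.repr.injective
      ext i
      rw [map_smul, Finsupp.smul_apply, hxw' i, ← hmv]
      rfl
    have hstab : ∀ σ : absoluteGaloisGroup ℚ, ∀ y ∈ (ℚ_[p] ∙ x),
        W.rationalGaloisRepTate p σ y ∈ (ℚ_[p] ∙ x) := by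
      intro σ y hy
      obtain ⟨c, rfl⟩ := Submodule.mem_span_singleton.mp hy
      obtain ⟨a, ha⟩ := hσx σ
      rw [map_smul, ha, smul_smul]
      exact Submodule.mem_span_singleton.mpr ⟨c * a, rfl⟩
    exact Literature.AlgebraicGeometry.Motives.finrank_ne_one_of_stable_of_not_hasRationalCM_of_numberField
      W p hCMr _ hstab (finrank_span_singleton hx0)
  -- oddness: `det ρ(c) = χ_p(c) = -1` at a complex conjugation `c`, so `ρ` is absolutely irreducible
  have habs : FramedRep.IsAbsolutelyIrreducible ρ := by
    obtain ⟨c, hc⟩ := exists_isComplexConjugation (Rat.castHom ℝ)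
    have hcc : c * c = 1 := by rw [← pow_two]; exact hc.sq_eq_one
    refine FramedRep.isAbsolutelyIrreducible_of_isIrreducible_of_det_eq_neg_one ρ hirrQ two_ne_zero
      hcc ?_
    apply Units.ext
    rw [Matrix.GeneralLinearGroup.val_det_apply, hρmat, det_map_coe, LinearMap.det_toMatrix bT, hρT,
      W.det_galoisRepTate_eq_cyclotomicCharacter_holds p hp0 c,
      GaloisRep.cyclotomicCharacter_of_isComplexConjugation p hc]
    push_cast
    rfl
  have hirr : ∀ v : Fin 2 → E, v ≠ 0 → ∃ g ∈ G, g ∈ GL2.congruenceSubgroup (p := p) 3 ∧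
      ¬ ∃ c : E, (((g : Matrix (Fin 2) (Fin 2) ℤ_[p]).map ((↑) : ℤ_[p] → ℚ_[p])).map
        (algebraMap ℚ_[p] E)) *ᵥ v = c • v := by
    intro v hv
    by_contra hall
    push Not at hall
    set r : absoluteGaloisGroup ℚ →* GL (Fin 2) E :=
      (Matrix.GeneralLinearGroup.map (algebraMap ℚ_[p] E)).comp ρ.toMonoidHom with hr
    have hrapply : ∀ τ, ((r τ : GL (Fin 2) E) : Matrix (Fin 2) (Fin 2) E) =
        (((ρ τ : GL (Fin 2) ℚ_[p]) : Matrix (Fin 2) (Fin 2) ℚ_[p])).map (algebraMap ℚ_[p] E) :=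
      fun τ ↦ rfl
    set V : Subgroup (absoluteGaloisGroup ℚ) := U.normalCore with hV
    haveI : V.Normal := Subgroup.normalCore_normal U
    have hVU : V ≤ U := Subgroup.normalCore_le U
    have hVopen : IsOpen (V : Set (absoluteGaloisGroup ℚ)) := isOpen_normalCore U hUopen
    have hVline : ∀ τ ∈ V, ∃ c : E, ((r τ : GL (Fin 2) E) : Matrix (Fin 2) (Fin 2) E) *ᵥ v = c • v := by
      intro τ hτ
      have hg3 : ρint τ ∈ GL2.congruenceSubgroup (p := p) 3 := hmemU.1 (hVU hτ)
      have hgG : ρint τ ∈ G := hmemG.2 ⟨τ, rfl⟩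
      obtain ⟨c, hc⟩ := hall (ρint τ) hgG hg3
      refine ⟨c, ?_⟩
      rw [hrapply, ← hρι τ, coe_map_coeRingHom]
      exact hc
    have hnoline : ∀ w : Fin 2 → E, w ≠ 0 → ∃ γ : absoluteGaloisGroup ℚ,
        ¬ ∃ c : E, ((r γ : GL (Fin 2) E) : Matrix (Fin 2) (Fin 2) E) *ᵥ w = c • w := by
      intro w hw
      obtain ⟨γ, hγ⟩ := exists_not_eigenline_of_isAbsolutelyIrreducible habs (algebraMap ℚ_[p] E) w hw
      exact ⟨γ, by rw [hrapply]; exact hγ⟩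
    rcases scalar_or_index_two_of_eigenline r V hnoline hv hVline with hscalar | ⟨H, hVH, hHind, hHtr⟩
    · /- (A) `ρ(V)` scalar: a Frobenius in `V` gives `a_q² = 4 q` -/
      have hdense := absoluteGaloisGroup.frobenius_dense Literature.NumberTheory.Automorphic.chebotarev_artinRep_holds ℚ Spl
        hSpl_fin
      obtain ⟨σ, hσV, w, hwS, 𝔓, h𝔓, hσ⟩ := hdense.inter_open_nonempty _ hVopen ⟨1, V.one_mem⟩
      obtain ⟨hnew, hgoodw⟩ := hgoodv hwS
      obtain ⟨htr, hdetσ⟩ := hgood hnew hgoodw h𝔓 hσ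
      obtain ⟨c, hc⟩ := hscalar σ hσV
      set q : ℕ := ((primesEquiv w : Nat.Primes) : ℕ) with hqdef
      set a : ℚ := (W.frobeniusTrace (primesEquiv w) : ℚ) with hadef
      have htrE : algebraMap ℚ_[p] E (a : ℚ_[p]) = 2 * c := by
        rw [← htr, ← trace_map_fin_two, ← hrapply, hc, Matrix.trace_smul, Matrix.trace_one,
          Fintype.card_fin, smul_eq_mul]
        push_cast
        ring
      have hdetE : algebraMap ℚ_[p] E ((q : ℚ_[p])) = c * c := by
        rw [hqdef, ← hdetσ, RingHom.map_det, RingHom.mapMatrix_apply, ← hrapply, hc, Matrix.det_smul,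
          Matrix.det_one, Fintype.card_fin, mul_one, pow_two]
      have hsqE : algebraMap ℚ_[p] E ((a : ℚ_[p]) ^ 2) = algebraMap ℚ_[p] E (4 * (q : ℚ_[p]) ^ 1) := by
        rw [map_pow, htrE, pow_one, map_mul, hdetE, map_ofNat]
        ring
      have hsqQℓ : ((a : ℚ_[p])) ^ 2 = 4 * (q : ℚ_[p]) ^ 1 := (algebraMap ℚ_[p] E).injective hsqE
      have hsqQ : a ^ 2 = 4 * (q : ℚ) ^ 1 := by
        have h : ((a ^ 2 : ℚ) : ℚ_[p]) = ((4 * (q : ℚ) ^ 1 : ℚ) : ℚ_[p]) := by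
          push_cast
          exact hsqQℓ
        exact_mod_cast h
      exact sq_ne_four_mul_prime_pow (primesEquiv w).2 odd_one a hsqQ
    · /- (B) the stabiliser `H` of index `2`: the primes with a Frobenius outside `H` are
        supersingular -/
      have hHopen : IsOpen (H : Set (absoluteGaloisGroup ℚ)) := Subgroup.isOpen_mono hVH hVopen
      have hkerV : ρint.ker ≤ V := by
        rw [hV]
        refine Subgroup.normal_le_normalCore.mpr fun τ hτ => ?_
        rw [hmemU, MonoidHom.mem_ker.mp hτ]
        exact Subgroup.one_mem _
      refine false_of_frobenius_not_mem_subset_density_zero H hHopen hHind Sbad hSbad_fin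
        (fun q hq hqS v hv 𝔓 h𝔓 τ hτ ↦ ?_) (serre_supersingular_density_zero_holds W hW)
        (fun q hq hqS v hv 𝔓 h𝔓 σ hσ hσH ↦ ?_)
      · -- inertia at a good prime `q ≠ p` acts trivially on `T_pE`
        obtain ⟨hne, -, hgv⟩ := hgoodq q hq hqS v hv
        have h1 : ρT τ = 1 :=
          W.galoisRepTate_eq_one_of_mem_inertia p hgv (natCast_not_mem_asIdeal_of_primesEquiv_ne hp hne)
            h𝔓 hτ
        refine hVH (hkerV ?_)
        rw [MonoidHom.mem_ker]
        apply Units.ext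
        rw [hρint, h1, LinearMap.toMatrix_one, Units.val_one]
      · -- `tr ρ(σ) = 0` for a Frobenius `σ ∉ H`, so `a_q = 0` and `q` is supersingular
        obtain ⟨hne, hgp, hgv⟩ := hgoodq q hq hqS v hv
        obtain ⟨htr, -⟩ := hgood hne hgv h𝔓 hσ
        have h0 := hHtr σ hσH
        rw [hrapply, trace_map_fin_two, htr, map_eq_zero] at h0
        have ha0 : (W.frobeniusTrace (primesEquiv v) : ℚ) = 0 := by exact_mod_cast h0
        have ha0' : W.frobeniusTrace (primesEquiv v) = 0 := by exact_mod_cast ha0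
        subst hv
        exact ⟨Fact.mk hq, hgp, by rw [ha0']; exact dvd_zero _⟩
  obtain ⟨s, hs2, hmeet⟩ := exists_meets_of_forall_exists_not_eigenline_of_det_ne_one hsq hirr hdet
  have hrange : ((ρ.toMonoidHom.range : Subgroup (GL (Fin 2) ℚ_[p])) : Set (GL (Fin 2) ℚ_[p])) =
      Set.range ⇑ρ := by
    rw [MonoidHom.coe_range]
    rfl
  have hGclosed : IsClosed ((G : Subgroup (GL (Fin 2) ℤ_[p])) : Set (GL (Fin 2) ℤ_[p])) := by
    rw [hG, Subgroup.coe_comap, hrange]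
    exact ((isCompact_range (map_continuous ρ)).isClosed).preimage continuous_map_coeRingHom
  have hle := congruenceSubgroup_le_of_isClosed hGclosed hs2 hmeet
  refine ⟨s, hs2, fun M hM => ?_⟩
  obtain ⟨τ, hτ⟩ := hmemG.1 (hle hM)
  exact ⟨τ, by rw [← hρint, hτ]⟩

end WeierstrassCurve

end
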